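import Mathlib.Analysis.InnerProductSpace.GramSchmidtOrtho
import Literature.Algebra.EuclideanLattices.SmoothingParameterBounds
import HarnessLib

/-!
# The Gram–Schmidt bound on the smoothing parameter, `η_ε(L) ≤ ‖B̃‖ √(ln(2n(1+1/ε))/π)` (GPV08 Lemma 3.1 = BLPRS13 Lemma 2.5)

Topic `Algebra/EuclideanLattices` (family `pqc`). Bottom layer of the decomposition of
Brakerski–Langlois–Peikert–Regev–Stehlé 2013 (`blprs_gapSVP_sqrt_dim_to_lwe_classical`, pqc.S21),
whose Lemma 2.5 is the Gram–Schmidt bound below (it governs the parameter `r ≥ ‖B̃‖ · √(…)` of the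
modulus-switching theorem, BLPRS Thm 3.1 / Lemma 3.5). Everything here is PROVED. The companion
bound with `λₙ(L)` in place of `‖B̃‖` (Micciancio–Regev 2007, Lemma 3.3) is already in the tree
(`SmoothingParameterSuccMin.lean`, by MR07's slab argument for LATTICE directions `vᵢ ∈ L`); the
Gram–Schmidt vectors `b̃ᵢ` are in general not lattice vectors, so we argue instead with half-spaces
in arbitrary directions, which gives the same final constant.

## Results

* `tsum_indicator_gaussianFunction_halfspace_le` — the half-space tail bound for lattice
  Gaussians: for a full lattice `Λ`, `s > 0` and `x ∈ V`,
  `ρ_s({w ∈ Λ | ⟪w, x⟫ ≥ ‖x‖²}) ≤ e^{-π‖x‖²/s²} ρ_s(Λ)` (complete the square and use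
  `ρ_s(Λ - x) ≤ ρ_s(Λ)`, `tsum_gaussianFunction_sub_le`).
* `tsum_ite_gaussianFunction_dual_le_of_cover` — if finitely many vectors `y₀, …, y_{k-1}` of norm
  `≤ M` "cover" the dual lattice in the sense that every nonzero `w ∈ L*` has `|⟪w, yᵢ⟫| ≥ 1` for
  some `i`, then `ρ_{1/s}(L* ∖ {0}) ≤ 2k e^{-πs²/M²} ρ_{1/s}(L*)`;
  `smoothingParameter_le_of_cover` — hence `η_ε(L) ≤ M √(ln(2k(1+1/ε))/π)` (MR07's computation:
  at `s = M √(ln(2k(1+1/ε))/π)`, `2k e^{-πs²/M²} = ε/(1+ε)`).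
* `smoothingParameter_le_norm_gramSchmidt_mul` — **Gentry–Peikert–Vaikuntanathan 2008, Lemma 3.1
  = BLPRS 2013, Lemma 2.5**: for any basis `B` of `L`, `η_ε(L) ≤ ‖B̃‖ · √(ln(2n(1+1/ε))/π)`,
  `‖B̃‖ = maxᵢ ‖b̃ᵢ‖` the longest Gram–Schmidt vector (cover by the Gram–Schmidt vectors: for
  `w ∈ L* ∖ {0}` and the least `i` with `⟪w, bᵢ⟫ ≠ 0`, `⟪w, b̃ᵢ⟫ = ⟪w, bᵢ⟫ ∈ ℤ ∖ {0}`).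

## Conventions

`ρ_s = gaussianFunction s`, `η_ε = smoothingParameter`, `L* = dualLattice L` (all the tree's,
`DiscreteGaussian.lean`, `DualLattice.lean`); Gram–Schmidt
is Mathlib's un-normalised `InnerProductSpace.gramSchmidt ℝ` in index order; bases of `L` are
`ℤ`-bases `b : Basis (Fin k) ℤ L` (so `k = n = finrank ℝ V` by full rank), and the bound is stated
for any `M ≥ maxᵢ ‖b̃ᵢ‖`. Natural logarithm (`Real.log`), as in MR07/GPV/BLPRS.

## References

* D. Micciancio, O. Regev, *Worst-case to average-case reductions based on Gaussian measures*,
  SIAM J. Comput. 37 (2007), Lemma 3.3 and its proof (authors' version p. 11–12).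
* C. Gentry, C. Peikert, V. Vaikuntanathan, *Trapdoors for hard lattices and new cryptographic
  constructions*, STOC 2008, Lemma 3.1.
* Z. Brakerski, A. Langlois, C. Peikert, O. Regev, D. Stehlé, *Classical hardness of learning with
  errors*, STOC 2013, Lemma 2.5 (arXiv:1306.0281).
* W. Banaszczyk, *New bounds in some transference theorems in the geometry of numbers*,
  Math. Ann. 296 (1993), Lemma 1.1 (the shift inequality behind the half-space bound).
-/

noncomputable section

open MeasureTheory Module Finset
open scoped Real ENNReal InnerProductSpace

namespace Literature.Algebra.EuclideanLattices

variable {V : Type*} [NormedAddCommGroup V] [InnerProductSpace ℝ V] [FiniteDimensional ℝ V]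
  [MeasurableSpace V] [BorelSpace V]

/-! ### The half-space tail bound -/

section Halfspace

omit [FiniteDimensional ℝ V] [MeasurableSpace V] [BorelSpace V] in
/-- Completing the square: if `⟪w, x⟫ ≥ ‖x‖²` then `‖w - x‖² ≤ ‖w‖² - ‖x‖²`, whence
`ρ_s(w) ≤ e^{-π‖x‖²/s²} ρ_s(w - x)`. [folklore] -/
theorem gaussianFunction_le_exp_mul_gaussianFunction_sub {s : ℝ} (hs : s ≠ 0) {w x : V}
    (h : ‖x‖ ^ 2 ≤ ⟪w, x⟫_ℝ) :
    gaussianFunction s w ≤ Real.exp (-π * ‖x‖ ^ 2 / s ^ 2) * gaussianFunction s (w - x) := by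
  rw [gaussianFunction, gaussianFunction, ← Real.exp_add]
  refine Real.exp_le_exp.2 ?_
  rw [norm_sub_sq_real w x, ← add_div, div_le_div_iff_of_pos_right (by positivity)]
  nlinarith [Real.pi_pos, h]

variable (Λ : Submodule ℤ V) [DiscreteTopology Λ] [IsZLattice ℝ Λ]

/-- **Half-space tail bound for lattice Gaussians**: for a full lattice `Λ`, `s > 0` and any
`x ∈ V`, the Gaussian mass of the lattice points in the half-space `{w | ⟪w, x⟫ ≥ ‖x‖²}` (the points
at least as far as `x` in the direction of `x`) is at most `e^{-π‖x‖²/s²} ρ_s(Λ)`. Proof: pointwise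
`ρ_s(w) ≤ e^{-π‖x‖²/s²} ρ_s(w - x)` on the half-space, then `ρ_s(Λ - x) ≤ ρ_s(Λ)`
(`tsum_gaussianFunction_sub_le`, Banaszczyk 1993, Lemma 1.1). Equivalently, for a unit vector `u`
and `t > 0`, `ρ_s({w ∈ Λ | ⟪w, u⟫ ≥ t}) ≤ e^{-πt²/s²} ρ_s(Λ)` (take `x = t u`). [folklore] -/
theorem tsum_indicator_gaussianFunction_halfspace_le {s : ℝ} (hs : 0 < s) (x : V) :
    ∑' w : Λ, {w : Λ | ‖x‖ ^ 2 ≤ ⟪(w : V), x⟫_ℝ}.indicator (fun w => gaussianFunction s (w : V)) w ≤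
      Real.exp (-π * ‖x‖ ^ 2 / s ^ 2) * ∑' w : Λ, gaussianFunction s (w : V) := by
  have hsum : Summable fun w : Λ => gaussianFunction s (w : V) :=
    (summable_gaussianFunction_sub Λ hs.ne' (0 : V)).congr fun w => by rw [sub_zero]
  have hsumx : Summable fun w : Λ => gaussianFunction s ((w : V) - x) :=
    summable_gaussianFunction_sub Λ hs.ne' x
  set S : Set Λ := {w : Λ | ‖x‖ ^ 2 ≤ ⟪(w : V), x⟫_ℝ} with hS
  have hle : ∀ w : Λ, S.indicator (fun w => gaussianFunction s (w : V)) w ≤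
      Real.exp (-π * ‖x‖ ^ 2 / s ^ 2) * gaussianFunction s ((w : V) - x) := by
    intro w
    by_cases hw : w ∈ S
    · rw [Set.indicator_of_mem hw]
      exact gaussianFunction_le_exp_mul_gaussianFunction_sub hs.ne' hw
    · rw [Set.indicator_of_notMem hw]
      exact mul_nonneg (Real.exp_pos _).le (gaussianFunction_pos _ _).le
  have hind : Summable (S.indicator fun w => gaussianFunction s (w : V)) := hsum.indicator S
  calc ∑' w, S.indicator (fun w => gaussianFunction s (w : V)) w
      ≤ ∑' w : Λ, Real.exp (-π * ‖x‖ ^ 2 / s ^ 2) * gaussianFunction s ((w : V) - x) :=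
        Summable.tsum_le_tsum hle hind (hsumx.mul_left _)
    _ = Real.exp (-π * ‖x‖ ^ 2 / s ^ 2) * ∑' w : Λ, gaussianFunction s ((w : V) - x) :=
        tsum_mul_left
    _ ≤ Real.exp (-π * ‖x‖ ^ 2 / s ^ 2) * ∑' w : Λ, gaussianFunction s (w : V) :=
        mul_le_mul_of_nonneg_left (tsum_gaussianFunction_sub_le Λ hs x) (Real.exp_pos _).le

end Halfspace

/-! ### The covering argument -/

section Cover

variable (L : Submodule ℤ V) [DiscreteTopology L] [IsZLattice ℝ L]

/-- **The covering bound** (the argument of Micciancio–Regev 2007, proof of Lemma 3.3, with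
half-spaces in place of the slabs `S_{i,j}`): let `y₀, …, y_{k-1} ∈ V` be nonzero vectors of norm
at most `M` such that every nonzero dual vector `w ∈ L*` satisfies `|⟪w, yᵢ⟫| ≥ 1` for some `i`.
Then for every `s > 0`, `ρ_{1/s}(L* ∖ {0}) ≤ 2k e^{-πs²/M²} ρ_{1/s}(L*)`. Indeed
`|⟪w, yᵢ⟫| ≥ 1` iff `|⟪w, xᵢ⟫| ≥ ‖xᵢ‖²` for `xᵢ = yᵢ/‖yᵢ‖²`, so `L* ∖ {0}` is covered by the `2k`
half-spaces `{⟪w, ±xᵢ⟫ ≥ ‖xᵢ‖²}`, each of dual mass `≤ e^{-π‖xᵢ‖²s²} ρ_{1/s}(L*)`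
(`tsum_indicator_gaussianFunction_halfspace_le` with parameter `1/s`), and `‖xᵢ‖ = 1/‖yᵢ‖ ≥ 1/M`.
[cite: MicciancioRegev2007, Lemma 3.3 (proof)] -/
theorem tsum_ite_gaussianFunction_dual_le_of_cover [DecidableEq (dualLattice L)] {k : ℕ}
    (y : Fin k → V) {M s : ℝ}
    (hs : 0 < s) (hM : ∀ i, ‖y i‖ ≤ M) (hy0 : ∀ i, y i ≠ 0)
    (hcover : ∀ w ∈ dualLattice L, w ≠ 0 → ∃ i, 1 ≤ |⟪w, y i⟫_ℝ|) :
    ∑' w : dualLattice L, (if w = 0 then 0 else gaussianFunction s⁻¹ (w : V)) ≤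
      2 * k * Real.exp (-π * s ^ 2 / M ^ 2) *
        ∑' w : dualLattice L, gaussianFunction s⁻¹ (w : V) := by
  have hσ : (0 : ℝ) < s⁻¹ := inv_pos.2 hs
  -- the covering vectors `xᵢ = yᵢ / ‖yᵢ‖²`
  set x : Fin k → V := fun i => (‖y i‖ ^ 2)⁻¹ • y i with hx
  have hyn : ∀ i, 0 < ‖y i‖ := fun i => norm_pos_iff.2 (hy0 i)
  have hxn : ∀ i, ‖x i‖ = ‖y i‖⁻¹ := by
    intro i
    rw [hx]
    simp only [norm_smul, norm_inv, norm_pow, Real.norm_eq_abs, abs_norm]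
    have := hyn i
    field_simp
  have hinner : ∀ (w : V) i, ⟪w, x i⟫_ℝ = (‖y i‖ ^ 2)⁻¹ * ⟪w, y i⟫_ℝ := by
    intro w i
    rw [hx]
    simp only [real_inner_smul_right]
  -- the `2k` half-space indicator functions
  set g : (dualLattice L) → ℝ := fun w => gaussianFunction s⁻¹ (w : V) with hg
  set F : Fin k → (dualLattice L) → ℝ := fun i w =>
    {w : (dualLattice L) | ‖x i‖ ^ 2 ≤ ⟪(w : V), x i⟫_ℝ}.indicator g w +
      {w : (dualLattice L) | ‖-x i‖ ^ 2 ≤ ⟪(w : V), -x i⟫_ℝ}.indicator g w with hF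
  have hg_nonneg : ∀ w, 0 ≤ g w := fun w => (gaussianFunction_pos _ _).le
  have hind_nonneg : ∀ (T : Set (dualLattice L)) w, 0 ≤ T.indicator g w := fun T w =>
    Set.indicator_nonneg (fun w _ => hg_nonneg w) w
  have hF_nonneg : ∀ i w, 0 ≤ F i w := fun i w => add_nonneg (hind_nonneg _ _) (hind_nonneg _ _)
  have hsum : Summable g :=
    (summable_gaussianFunction_sub (dualLattice L) hσ.ne' (0 : V)).congr fun w => by rw [sub_zero]
  have hFsum : ∀ i, Summable (F i) := fun i => (hsum.indicator _).add (hsum.indicator _)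
  -- pointwise domination of the punctured Gaussian by the sum of the indicators
  have hpt : ∀ w : (dualLattice L), (if w = 0 then 0 else g w) ≤ ∑ i, F i w := by
    intro w
    split_ifs with hw
    · exact Finset.sum_nonneg fun i _ => hF_nonneg i w
    · have hw' : (w : V) ≠ 0 := fun h => hw (Subtype.ext h)
      obtain ⟨i, hi⟩ := hcover w w.2 hw'
      refine le_trans ?_ (Finset.single_le_sum (fun j _ => hF_nonneg j w) (Finset.mem_univ i))
      -- `w` lies in one of the two half-spaces of direction `i`
      have hxi : ‖x i‖ ^ 2 ≤ |⟪(w : V), x i⟫_ℝ| := by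
        rw [hinner, abs_mul, abs_inv, abs_of_pos (pow_pos (hyn i) 2), hxn, inv_pow]
        have h2 : 0 < (‖y i‖ ^ 2)⁻¹ := inv_pos.2 (pow_pos (hyn i) 2)
        calc (‖y i‖ ^ 2)⁻¹ = (‖y i‖ ^ 2)⁻¹ * 1 := (mul_one _).symm
          _ ≤ (‖y i‖ ^ 2)⁻¹ * |⟪(w : V), y i⟫_ℝ| := mul_le_mul_of_nonneg_left hi h2.le
      rcases le_or_gt 0 ⟪(w : V), x i⟫_ℝ with hpos | hneg
      · have hmem : w ∈ {w : (dualLattice L) | ‖x i‖ ^ 2 ≤ ⟪(w : V), x i⟫_ℝ} := by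
          simpa [abs_of_nonneg hpos] using hxi
        simp only [hF, Set.indicator_of_mem hmem]
        exact le_add_of_nonneg_right (hind_nonneg _ _)
      · have hmem : w ∈ {w : (dualLattice L) | ‖-x i‖ ^ 2 ≤ ⟪(w : V), -x i⟫_ℝ} := by
          simp only [Set.mem_setOf_eq, norm_neg, inner_neg_right]
          simpa [abs_of_neg hneg] using hxi
        simp only [hF, Set.indicator_of_mem hmem]
        exact le_add_of_nonneg_left (hind_nonneg _ _)
  -- each indicator has small mass
  have hexp : ∀ i, Real.exp (-π * ‖x i‖ ^ 2 / s⁻¹ ^ 2) ≤ Real.exp (-π * s ^ 2 / M ^ 2) := by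
    intro i
    have hMi : 0 < M := (hyn i).trans_le (hM i)
    rw [Real.exp_le_exp, hxn, inv_pow, inv_pow, div_inv_eq_mul]
    have h1 : -π * (‖y i‖ ^ 2)⁻¹ * s ^ 2 = -(π * s ^ 2 / ‖y i‖ ^ 2) := by ring
    have h2 : -π * s ^ 2 / M ^ 2 = -(π * s ^ 2 / M ^ 2) := by ring
    rw [h1, h2, neg_le_neg_iff]
    exact div_le_div_of_nonneg_left (by positivity) (pow_pos (hyn i) 2)
      (pow_le_pow_left₀ (hyn i).le (hM i) 2)
  have hFi : ∀ i, ∑' w, F i w ≤ 2 * Real.exp (-π * s ^ 2 / M ^ 2) * ∑' w, g w := by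
    intro i
    have hA : ∑' w, {w : (dualLattice L) | ‖x i‖ ^ 2 ≤ ⟪(w : V), x i⟫_ℝ}.indicator g w ≤
        Real.exp (-π * ‖x i‖ ^ 2 / s⁻¹ ^ 2) * ∑' w, g w :=
      tsum_indicator_gaussianFunction_halfspace_le (dualLattice L) hσ (x i)
    have hB : ∑' w, {w : (dualLattice L) | ‖-x i‖ ^ 2 ≤ ⟪(w : V), -x i⟫_ℝ}.indicator g w ≤
        Real.exp (-π * ‖-x i‖ ^ 2 / s⁻¹ ^ 2) * ∑' w, g w :=
      tsum_indicator_gaussianFunction_halfspace_le (dualLattice L) hσ (-x i)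
    have hexp' : Real.exp (-π * ‖-x i‖ ^ 2 / s⁻¹ ^ 2) ≤ Real.exp (-π * s ^ 2 / M ^ 2) := by
      rw [norm_neg]
      exact hexp i
    have hgs : 0 ≤ ∑' w, g w := tsum_nonneg hg_nonneg
    have hsplit : ∑' w, F i w = ∑' w, {w : (dualLattice L) | ‖x i‖ ^ 2 ≤ ⟪(w : V), x i⟫_ℝ}.indicator g w +
        ∑' w, {w : (dualLattice L) | ‖-x i‖ ^ 2 ≤ ⟪(w : V), -x i⟫_ℝ}.indicator g w :=
      Summable.tsum_add (hsum.indicator _) (hsum.indicator _)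
    rw [hsplit]
    calc _ ≤ Real.exp (-π * ‖x i‖ ^ 2 / s⁻¹ ^ 2) * ∑' w, g w +
          Real.exp (-π * ‖-x i‖ ^ 2 / s⁻¹ ^ 2) * ∑' w, g w := add_le_add hA hB
      _ ≤ Real.exp (-π * s ^ 2 / M ^ 2) * ∑' w, g w +
          Real.exp (-π * s ^ 2 / M ^ 2) * ∑' w, g w :=
          add_le_add (mul_le_mul_of_nonneg_right (hexp i) hgs)
            (mul_le_mul_of_nonneg_right hexp' hgs)
      _ = 2 * Real.exp (-π * s ^ 2 / M ^ 2) * ∑' w, g w := by ring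
  -- sum up
  calc ∑' w : (dualLattice L), (if w = 0 then 0 else g w)
      ≤ ∑' w, ∑ i, F i w :=
        Summable.tsum_le_tsum hpt (by
          refine Summable.of_nonneg_of_le (fun w => ?_) hpt (summable_sum fun i _ => hFsum i)
          split_ifs
          · exact le_rfl
          · exact hg_nonneg w) (summable_sum fun i _ => hFsum i)
    _ = ∑ i, ∑' w, F i w := Summable.tsum_finsetSum fun i _ => hFsum i
    _ ≤ ∑ _i : Fin k, 2 * Real.exp (-π * s ^ 2 / M ^ 2) * ∑' w, g w :=
        Finset.sum_le_sum fun i _ => hFi i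
    _ = 2 * k * Real.exp (-π * s ^ 2 / M ^ 2) * ∑' w, g w := by
        rw [Finset.sum_const, Finset.card_univ, Fintype.card_fin, nsmul_eq_mul]
        ring

/-- **Smoothing bound from a cover** (conclusion of the argument of Micciancio–Regev 2007,
Lemma 3.3): under the hypotheses of `tsum_ite_gaussianFunction_dual_le_of_cover`, for every
`ε > 0`, `η_ε(L) ≤ M · √(ln(2k(1+1/ε))/π)`. Indeed for `s = M √(ln(2k(1+1/ε))/π)` one has
`2k e^{-πs²/M²} = ε/(1+ε)`, so `ρ' := ρ_{1/s}(L* ∖ {0})` satisfies `ρ' ≤ (ε/(1+ε))(1 + ρ')`, i.e.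
`ρ' ≤ ε`, and `η_ε(L)` is the infimum of such `s`. (For `k = 0` the cover hypothesis forces
`L* = {0}`, i.e. the zero space, where both sides vanish.) [cite: MicciancioRegev2007, Lemma 3.3 (proof)] -/
theorem smoothingParameter_le_of_cover {k : ℕ} (y : Fin k → V) {M ε : ℝ} (hε : 0 < ε)
    (hM : ∀ i, ‖y i‖ ≤ M) (hy0 : ∀ i, y i ≠ 0)
    (hcover : ∀ w ∈ dualLattice L, w ≠ 0 → ∃ i, 1 ≤ |⟪w, y i⟫_ℝ|) :
    smoothingParameter L ε ≤ M * Real.sqrt (Real.log (2 * k * (1 + 1 / ε)) / π) := by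
  classical
  have hbdd : BddBelow {s : ℝ | 0 < s ∧
      gaussianMass (1 / s) 0 ((dualLattice L : Set V) \ {0}) ≤ ENNReal.ofReal ε} :=
    ⟨0, fun _ h => h.1.le⟩
  -- the mass bound at any `s > 0`, in real terms
  have key : ∀ {s : ℝ}, 0 < s →
      ∑' w : dualLattice L, (if w = 0 then 0 else gaussianFunction s⁻¹ (w : V)) ≤
        2 * k * Real.exp (-π * s ^ 2 / M ^ 2) *
          (1 + ∑' w : dualLattice L, (if w = 0 then 0 else gaussianFunction s⁻¹ (w : V))) := by
    intro s hs
    have h := tsum_ite_gaussianFunction_dual_le_of_cover L y hs hM hy0 hcover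
    have hsum : Summable fun w : dualLattice L => gaussianFunction s⁻¹ (w : V) :=
      (summable_gaussianFunction_sub (dualLattice L) (inv_ne_zero hs.ne') (0 : V)).congr
        fun w => by rw [sub_zero]
    have hsplit := hsum.tsum_eq_add_tsum_ite (0 : dualLattice L)
    simp only [ZeroMemClass.coe_zero, gaussianFunction_zero] at hsplit
    rwa [hsplit] at h
  -- from the real bound at `s` to membership in the defining set of `η_ε`
  have mem_of : ∀ {s : ℝ}, 0 < s → 2 * k * Real.exp (-π * s ^ 2 / M ^ 2) ≤ ε / (1 + ε) →
      s ∈ {s : ℝ | 0 < s ∧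
        gaussianMass (1 / s) 0 ((dualLattice L : Set V) \ {0}) ≤ ENNReal.ofReal ε} := by
    intro s hs hc
    refine ⟨hs, ?_⟩
    rw [gaussianMass_dual_sdiff_zero_eq_ofReal_tsum_ite L (one_div_ne_zero hs.ne'), one_div]
    refine ENNReal.ofReal_le_ofReal ?_
    set T := ∑' w : dualLattice L, (if w = 0 then 0 else gaussianFunction s⁻¹ (w : V)) with hT
    have hT0 : 0 ≤ T := tsum_nonneg fun w => by
      split_ifs
      · exact le_rfl
      · exact (gaussianFunction_pos _ _).le
    have h1 : T ≤ ε / (1 + ε) * (1 + T) :=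
      (key hs).trans (mul_le_mul_of_nonneg_right hc (by linarith))
    have hε1 : 0 < 1 + ε := by linarith
    rw [div_mul_eq_mul_div, le_div_iff₀ hε1] at h1
    nlinarith
  rcases Nat.eq_zero_or_pos k with hk | hk
  · -- `k = 0`: no nonzero dual vectors; both sides are `0`
    subst hk
    have hrhs : M * Real.sqrt (Real.log (2 * (0 : ℕ) * (1 + 1 / ε)) / π) = 0 := by simp
    rw [hrhs]
    refine le_of_forall_gt_imp_ge_of_dense fun s hs => ?_
    refine csInf_le hbdd (mem_of hs ?_)
    simp only [CharP.cast_eq_zero, mul_zero, zero_mul]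
    exact div_nonneg hε.le (by linarith)
  · -- `k ≥ 1`: `M > 0` and the choice `s₀ = M √(ln(2k(1+1/ε))/π)`
    have hM0 : 0 < M := (norm_pos_iff.2 (hy0 ⟨0, hk⟩)).trans_le (hM ⟨0, hk⟩)
    have hk1 : (1 : ℝ) ≤ k := by exact_mod_cast hk
    set A : ℝ := 2 * k * (1 + 1 / ε) with hA
    have hA1 : 1 < A := by
      have : (1 : ℝ) < 1 + 1 / ε := by
        have := one_div_pos.2 hε
        linarith
      calc (1 : ℝ) ≤ 2 * k := by linarith
        _ = 2 * k * 1 := (mul_one _).symm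
        _ < 2 * k * (1 + 1 / ε) := mul_lt_mul_of_pos_left this (by linarith)
    have hA0 : 0 < A := one_pos.trans hA1
    have hlog : 0 < Real.log A := Real.log_pos hA1
    set s₀ : ℝ := M * Real.sqrt (Real.log A / π) with hs₀
    have hsq : 0 < Real.sqrt (Real.log A / π) := Real.sqrt_pos.2 (div_pos hlog Real.pi_pos)
    have hs₀pos : 0 < s₀ := mul_pos hM0 hsq
    refine csInf_le hbdd (mem_of hs₀pos (le_of_eq ?_))
    -- `2k e^{-π s₀²/M²} = 2k/A = ε/(1+ε)`
    have hs₀sq : s₀ ^ 2 = M ^ 2 * (Real.log A / π) := by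
      rw [hs₀, mul_pow, Real.sq_sqrt (div_pos hlog Real.pi_pos).le]
    have hexp : Real.exp (-π * s₀ ^ 2 / M ^ 2) = A⁻¹ := by
      rw [hs₀sq]
      have : -π * (M ^ 2 * (Real.log A / π)) / M ^ 2 = -Real.log A := by
        field_simp
      rw [this, Real.exp_neg, Real.exp_log hA0]
    rw [hexp, hA]
    have hε0 : ε ≠ 0 := hε.ne'
    have hk0 : (k : ℝ) ≠ 0 := by positivity
    field_simp
    ring

end Cover

/-! ### GPV08 Lemma 3.1 = BLPRS Lemma 2.5: the Gram–Schmidt bound -/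

section GramSchmidt

variable (L : Submodule ℤ V) [DiscreteTopology L] [IsZLattice ℝ L]

/-- **Gentry–Peikert–Vaikuntanathan 2008, Lemma 3.1 (= BLPRS 2013, Lemma 2.5)**: for any `ε > 0`
and any (full-rank, `n`-dimensional) lattice `L` with basis `B = (b₀, …, b_{n-1})`,
`η_ε(L) ≤ ‖B̃‖ · √(ln(2n(1+1/ε))/π)`, where `B̃` is the Gram–Schmidt orthogonalisation of `B` (in
index order, un-normalised) and `‖B̃‖ = maxᵢ ‖b̃ᵢ‖`; stated for a `ℤ`-basis `b : Basis (Fin k) ℤ L`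
(`k = n`) and any `M` with `‖b̃ᵢ‖ ≤ M` for all `i`. Proof (GPV): for `w ∈ L* ∖ {0}` let `i` be the
least index with `⟪w, bᵢ⟫ ≠ 0` (it exists since the `bᵢ` span `V`); as `bᵢ - b̃ᵢ ∈ span(b_j : j < i) ⊥ w`,
`⟪w, b̃ᵢ⟫ = ⟪w, bᵢ⟫ ∈ ℤ ∖ {0}`, so `|⟪w, b̃ᵢ⟫| ≥ 1`; conclude by the covering bound
`smoothingParameter_le_of_cover` applied to the Gram–Schmidt vectors.
[cite: BrakerskiEtAl2013, Lemma 2.5] -/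
theorem smoothingParameter_le_norm_gramSchmidt_mul {k : ℕ} (b : Basis (Fin k) ℤ L) {ε M : ℝ}
    (hε : 0 < ε)
    (hM : ∀ i, ‖InnerProductSpace.gramSchmidt ℝ (fun j => ((b j : L) : V)) i‖ ≤ M) :
    smoothingParameter L ε ≤ M * Real.sqrt (Real.log (2 * k * (1 + 1 / ε)) / π) := by
  classical
  set f : Fin k → V := fun j => ((b j : L) : V) with hf
  set B := b.ofZLatticeBasis ℝ L with hB
  have hBf : (B : Fin k → V) = f := by
    funext j
    simp [hB, hf, Module.Basis.ofZLatticeBasis_apply]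
  have hlin : LinearIndependent ℝ f := hBf ▸ B.linearIndependent
  have hspan_top : Submodule.span ℝ (Set.range f) = ⊤ := hBf ▸ B.span_eq
  set g : Fin k → V := InnerProductSpace.gramSchmidt ℝ f with hg
  have hg0 : ∀ i, g i ≠ 0 := fun i => InnerProductSpace.gramSchmidt_ne_zero i hlin
  have hcover : ∀ w ∈ dualLattice L, w ≠ 0 → ∃ i, 1 ≤ |⟪w, g i⟫_ℝ| := by
    intro w hw hw0
    -- some `⟪w, bᵢ⟫` is nonzero, since the `bᵢ` span `V`
    have hex : ∃ i, ⟪w, f i⟫_ℝ ≠ 0 := by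
      by_contra hcon
      push Not at hcon
      have hker : Submodule.span ℝ (Set.range f) ≤ LinearMap.ker (innerₛₗ ℝ w) :=
        Submodule.span_le.2 (Set.range_subset_iff.2 fun i => by simp [hcon i])
      rw [hspan_top, top_le_iff, LinearMap.ker_eq_top] at hker
      have hww : ⟪w, w⟫_ℝ = 0 := by
        have := LinearMap.congr_fun hker w
        simpa using this
      exact hw0 (inner_self_eq_zero.1 hww)
    -- the least such index
    set P : Set (Fin k) := {i | ⟪w, f i⟫_ℝ ≠ 0} with hP
    have hPne : P.Nonempty := hex
    set i₀ := (wellFounded_lt (α := Fin k)).min P hPne with hi₀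
    have hi₀P : ⟪w, f i₀⟫_ℝ ≠ 0 := (wellFounded_lt (α := Fin k)).min_mem P hPne
    have hmin : ∀ j, j < i₀ → ⟪w, f j⟫_ℝ = 0 := by
      intro j hj
      by_contra hne
      exact (wellFounded_lt (α := Fin k)).not_lt_min P (show j ∈ P from hne) hj
    -- `w ⊥ span (f '' Iio i₀) = span (g '' Iio i₀)`
    have horth : ∀ u ∈ Submodule.span ℝ (g '' Set.Iio i₀), ⟪w, u⟫_ℝ = 0 := by
      intro u hu
      rw [InnerProductSpace.span_gramSchmidt_Iio ℝ f i₀] at hu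
      have hker : Submodule.span ℝ (f '' Set.Iio i₀) ≤ LinearMap.ker (innerₛₗ ℝ w) :=
        Submodule.span_le.2 (by
          rintro _ ⟨j, hj, rfl⟩
          simp [hmin j hj])
      have := hker hu
      simpa using this
    -- hence `⟪w, g i₀⟫ = ⟪w, f i₀⟫`
    have hgi : ⟪w, f i₀⟫_ℝ = ⟪w, g i₀⟫_ℝ := by
      conv_lhs => rw [InnerProductSpace.gramSchmidt_def'' ℝ f i₀]
      rw [inner_add_right, add_eq_left]
      refine horth _ (Submodule.sum_mem _ fun j hj =>
        Submodule.smul_mem _ _ (Submodule.subset_span ?_))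
      exact ⟨j, Finset.mem_Iio.1 hj, rfl⟩
    -- and `⟪w, f i₀⟫` is a nonzero integer
    obtain ⟨m, hm⟩ := mem_dualLattice.1 hw (f i₀) (b i₀).2
    have hm0 : m ≠ 0 := by
      rintro rfl
      exact hi₀P (by rw [← hm, Int.cast_zero])
    refine ⟨i₀, ?_⟩
    rw [← hgi, ← hm]
    exact_mod_cast Int.one_le_abs hm0
  exact smoothingParameter_le_of_cover L g hε hM hg0 hcover

end GramSchmidt

end Literature.Algebra.EuclideanLattices

end
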